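import Summits.BirchSwinnertonDyer.BirchSwinnertonDyer.Theorems.EisensteinPrimesResidualDevissageCountSharp
import Summits.BirchSwinnertonDyer.BirchSwinnertonDyer.Theorems.EisensteinPrimesResidualDevissageCountLower
import HarnessLib

/-!
# The residual surjectivity `R_𝔭^Σ(K_∞, B) ↠ R_𝔭^Σ(K_∞, C)` from TWO standard-shape surjectivities: a global one
# (`q_*` on the classes unramified outside `Σ`) and a local one (weak approximation for `A` at the places above `𝔭`)
# (cell `bsd-eis`, seat `bsd-line-x2-p2` gen 5, D-0154 KEY row 5; crux 4 `BSDpOnCellC` line b1; sequel of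
# `…ResidualDevissageCount{,Lower,Sharp,Nonsplit,NonsplitIdentity}`)

HONEST FRAMING (cell `bsd-eis`, run/shared/lean/pub/bsd-eis/): Galois-cohomology bookkeeping on constructed objects; no definition,
no named fact, no `sorry`, no `Theses` import; nothing about BSD or a main conjecture is asserted; nothing booked; no label or count
moves. Helper `--supports stmt-BirchSwinnertonDyer-19034`; closes no stub.

The ONE input left in the «`≥`» half of the residual λ-count (files 2–5) is the surjectivity of
`q_* : R(B) → R(C)`, `R(·) = datumStrictSelmer (ker κ) · p (bdpData · p 𝔭) Σ`. This file splits it into the two statements the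
printed proofs actually invoke (Greenberg–Vatsal Prop. 2.1 / Pollack–Weston Prop. A.2 shape), for a `Γ_K`-equivariant exact
`0 → A —j→ B —q→ C → 0`, `H = ker κ`, `p^c` elements `τ i` controlling the places above `𝔭` for `B` (`hreps`, Brink):

* (Glob) every class of `R(C)` lifts to a class of `B` UNRAMIFIED OUTSIDE `Σ ∪ {p}`:
  `∀ z ∈ R(C), ∃ y ∈ H¹_Σ(K_∞, B) := unramifiedOutside H B p Σ, q_* y = z` (⟸ `H²`-vanishing / surjectivity of
  `H¹(K_Σ/K_∞, B) → H¹(K_Σ/K_∞, C)`);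
* (Loc) weak approximation for `A` at the `p^c` places above `𝔭` inside `H¹_Σ(K_∞, A)`:
  `∀ w : Fin p^c → H¹(H ⊓ D_𝔭, A), ∃ a ∈ H¹_Σ(K_∞, A), ∀ i, res_{H ⊓ D_𝔭}(conj_{τ i} a) = w i`.

* §1 `surjOn_datumStrictSelmer_of_global_of_local` — (Glob) ∧ (Loc) ⟹ **`∀ z ∈ R(C), ∃ y ∈ R(B), q_* y = z`**: lift `z` to `y`
  by (Glob); each `res_{H ⊓ D_𝔭}(conj_{τ i} y)` dies in `H¹(H ⊓ D_𝔭, C)` (strictness of `z`), so equals `j_* w_i` (middle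
  exactness at `H ⊓ D_𝔭`); (Loc) gives `a` with those local components; `y − j_* a` is unramified outside `Σ`, strict at all places
  above `𝔭` (representatives), relaxed elsewhere above `p`, and maps to `z` (`q ∘ j = 0`).
* §2 `natCard_mul_natCard_le_of_global_of_local` — hence the LOWER count of file 3 §3:
  **`#R(A) · #R(C) ≤ #R(B) · #C^{G_{K_∞}}`** from (Glob) ∧ (Loc); §3 the elliptic-curve form along a stable `Φ ≤ E[p]`.

References: [GreenbergVatsal2000] §2 Prop. (2.1), pp. 25–26; [PollackWeston2011] App. A Prop. A.2; [KellerYin2024] Rem. 1.4.2, Thm. 1.4.1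
(arXiv:2402.12781v2 §1.4); [SerreGaloisCohomology1997] I.§2.2; cell p633072, p633662, p634082 (this seat).
-/

set_option autoImplicit false
set_option linter.dupNamespace false -- the summit namespace `…BirchSwinnertonDyer.BirchSwinnertonDyer.Theorems` (Sub = Summit, D-0017) trips it

noncomputable section

open scoped Classical

namespace Summit.BirchSwinnertonDyer.BirchSwinnertonDyer.Theorems.ResidualDevissageSurjectivity

open Literature.NumberTheory.EllipticCurves Literature.NumberTheory.EllipticCurves.GreenbergSelmer
  Literature.NumberTheory.EllipticCurves.GreenbergVatsal2000 Literature.NumberTheory.GaloisRepresentations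
  Literature.NumberTheory.EllipticCurves.FineSelmerCoefficientMap
  NumberField IsDedekindDomain Field WeierstrassCurve
  Summit.BirchSwinnertonDyer.Rank1Residual.X11b Summit.BirchSwinnertonDyer.Rank1Residual.X11b.AcSelmer
  Summit.BirchSwinnertonDyer.Rank1Residual.X2.ResidualDevissageModules
  Summit.BirchSwinnertonDyer.BirchSwinnertonDyer.Theorems.UniversalToricDescentResidualSelmer
  Summit.BirchSwinnertonDyer.BirchSwinnertonDyer.Theorems.UniversalToricDescentResidualSelmerFinite
  Summit.BirchSwinnertonDyer.BirchSwinnertonDyer.Theorems.CumulativeHeegnerInclusionAtThreeStubB1Devissage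
  Summit.BirchSwinnertonDyer.BirchSwinnertonDyer.Theorems.CumulativeHeegnerInclusionAtThreeStubB1DevissageNamed
  Summit.BirchSwinnertonDyer.BirchSwinnertonDyer.Theorems.CumulativeHeegnerInclusionAtThreeResidualDevissage
  Summit.BirchSwinnertonDyer.BirchSwinnertonDyer.Theorems.ResidualDevissageFiniteKernel
  Summit.BirchSwinnertonDyer.BirchSwinnertonDyer.Theorems.ResidualDevissageCount

/-! ### §1 (Glob) ∧ (Loc) ⟹ `q_* : R(B) → R(C)` is onto -/

section Residual

variable {K : Type} [Field K] [NumberField K] {p : ℕ} [Fact p.Prime] (κ : ZpExtension K p)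
  (𝔭 : HeightOneSpectrum (𝓞 K)) (S₀ : Set (HeightOneSpectrum (𝓞 K)))

variable {A : Type} [AddCommGroup A] [DistribMulAction (absoluteGaloisGroup K) A] [TopologicalSpace A]
  [DiscreteTopology A]
variable {B : Type} [AddCommGroup B] [DistribMulAction (absoluteGaloisGroup K) B] [TopologicalSpace B]
  [DiscreteTopology B]
variable {C : Type} [AddCommGroup C] [DistribMulAction (absoluteGaloisGroup K) C] [TopologicalSpace C]
  [DiscreteTopology C]

/-- **The residual surjectivity from a global and a local surjectivity.** For a `Γ_K`-equivariant exact
`0 → A —j→ B —q→ C → 0` of discrete modules (continuous orbits on `B`, `q ∘ j = 0`), `H = ker κ`, `p^c` elements `τ i ∈ Γ_K`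
controlling the strict condition of `B` above `𝔭` (`hreps`): IF (Glob) every `z ∈ R(C)` is `q_* y` for some `y ∈ H¹(H, B)`
unramified outside `Σ ∪ {p}`, and (Loc) every tuple `(w_i)_{i<p^c}` of classes in `H¹(H ⊓ D_𝔭, A)` is
`(res_{H ⊓ D_𝔭} conj_{τ i} a)_i` for some `a ∈ H¹(H, A)` unramified outside `Σ ∪ {p}`, THEN `q_*` maps `R(B)` ONTO `R(C)`.
[cite: GreenbergVatsal2000, §2 Prop. (2.1) and pp. 25–26] [cite: PollackWeston2011, App. A Prop. A.2]
[cite: KellerYin2024, Rem. 1.4.2 (arXiv:2402.12781v2 §1.4)] [cite: SerreGaloisCohomology1997, I.§2.2] -/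
theorem surjOn_datumStrictSelmer_of_global_of_local
    (h𝔭 : ((p : ℕ) : 𝓞 K) ∈ 𝔭.asIdeal) (j : A →+ B)
    (hj' : ∀ (σ : absoluteGaloisGroup K) (a : A), j (σ • a) = σ • j a) (hinj : Function.Injective j)
    (q : B →+ C) (hq' : ∀ (σ : absoluteGaloisGroup K) (b : B), q (σ • b) = σ • q b)
    (hqj : ∀ a : A, q (j a) = 0) (hsurj : Function.Surjective q) (hexact : ∀ b : B, q b = 0 → ∃ a : A, j a = b)
    (hcontB : ∀ b : B, Continuous fun g : absoluteGaloisGroup K ↦ g • b)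
    (c : ℕ) (τ : ℕ → absoluteGaloisGroup K)
    (hrepsB : ∀ y : Literature.NumberTheory.EllipticCurves.subgroupH1 κ.kerSubgroup B,
      (∀ i, i < p ^ c → resOfLe B (inf_le_left : κ.kerSubgroup ⊓ decomp 𝔭 ≤ κ.kerSubgroup)
        (conjH1 κ.kerSubgroup B (τ i) y) = 0) →
      ∀ σ : absoluteGaloisGroup K, resOfLe B (inf_le_left : κ.kerSubgroup ⊓ decomp 𝔭 ≤ κ.kerSubgroup)
        (conjH1 κ.kerSubgroup B σ y) = 0)
    (hglob : ∀ z ∈ datumStrictSelmer κ.kerSubgroup C p (AcSelmer.bdpData C p 𝔭) S₀,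
      ∃ y ∈ unramifiedOutside κ.kerSubgroup B p S₀,
        resH1Hom (ContinuousMonoidHom.id κ.kerSubgroup) q (fun _ b ↦ hq' _ b) y = z)
    (hloc : ∀ w : Fin (p ^ c) → Literature.NumberTheory.EllipticCurves.subgroupH1 (κ.kerSubgroup ⊓ decomp 𝔭) A,
      ∃ a ∈ unramifiedOutside κ.kerSubgroup A p S₀,
        ∀ i : Fin (p ^ c), resOfLe A (inf_le_left : κ.kerSubgroup ⊓ decomp 𝔭 ≤ κ.kerSubgroup)
          (conjH1 κ.kerSubgroup A (τ i) a) = w i) :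
    ∀ z ∈ datumStrictSelmer κ.kerSubgroup C p (AcSelmer.bdpData C p 𝔭) S₀,
      ∃ y ∈ datumStrictSelmer κ.kerSubgroup B p (AcSelmer.bdpData B p 𝔭) S₀,
        resH1Hom (ContinuousMonoidHom.id κ.kerSubgroup) q (fun _ b ↦ hq' _ b) y = z := by
  -- notation and the commuting squares
  let H := κ.kerSubgroup
  let jH := resH1Hom (ContinuousMonoidHom.id H) j (fun _ a ↦ hj' _ a)
  let qH := resH1Hom (ContinuousMonoidHom.id H) q (fun _ b ↦ hq' _ b)
  let jD := resH1Hom (ContinuousMonoidHom.id ↥(H ⊓ decomp 𝔭)) j (fun _ a ↦ hj' _ a)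
  let qD := resH1Hom (ContinuousMonoidHom.id ↥(H ⊓ decomp 𝔭)) q (fun _ b ↦ hq' _ b)
  have hconjA : ∀ (σ : absoluteGaloisGroup K) (x : Literature.NumberTheory.EllipticCurves.subgroupH1 H A),
      conjH1 H B σ (jH x) = jH (conjH1 H A σ x) := fun σ x ↦
    congrArg (fun f : Literature.NumberTheory.EllipticCurves.subgroupH1 H A →+
        Literature.NumberTheory.EllipticCurves.subgroupH1 H B ↦ f x)
      (conjH1_comp_resH1Hom_id H j (fun _ a ↦ hj' _ a) hj' σ)
  have hconjB : ∀ (σ : absoluteGaloisGroup K) (y : Literature.NumberTheory.EllipticCurves.subgroupH1 H B),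
      conjH1 H C σ (qH y) = qH (conjH1 H B σ y) := fun σ y ↦
    congrArg (fun f : Literature.NumberTheory.EllipticCurves.subgroupH1 H B →+
        Literature.NumberTheory.EllipticCurves.subgroupH1 H C ↦ f y)
      (conjH1_comp_resH1Hom_id H q (fun _ b ↦ hq' _ b) hq' σ)
  have hresA : ∀ x : Literature.NumberTheory.EllipticCurves.subgroupH1 H A,
      resOfLe B (inf_le_left : H ⊓ decomp 𝔭 ≤ H) (jH x) = jD (resOfLe A (inf_le_left : H ⊓ decomp 𝔭 ≤ H) x) :=
    fun x ↦ by
    have e := congrArg (fun f : Literature.NumberTheory.EllipticCurves.subgroupH1 H A →+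
        Literature.NumberTheory.EllipticCurves.subgroupH1 (H ⊓ decomp 𝔭) B ↦ f x)
      (resOfLe_comp_resH1Hom_id (inf_le_left : H ⊓ decomp 𝔭 ≤ H) j (fun _ a ↦ hj' _ a) (fun _ a ↦ hj' _ a))
    simpa only [AddMonoidHom.comp_apply] using e
  have hresB : ∀ y : Literature.NumberTheory.EllipticCurves.subgroupH1 H B,
      resOfLe C (inf_le_left : H ⊓ decomp 𝔭 ≤ H) (qH y) = qD (resOfLe B (inf_le_left : H ⊓ decomp 𝔭 ≤ H) y) :=
    fun y ↦ by
    have e := congrArg (fun f : Literature.NumberTheory.EllipticCurves.subgroupH1 H B →+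
        Literature.NumberTheory.EllipticCurves.subgroupH1 (H ⊓ decomp 𝔭) C ↦ f y)
      (resOfLe_comp_resH1Hom_id (inf_le_left : H ⊓ decomp 𝔭 ≤ H) q (fun _ b ↦ hq' _ b) (fun _ b ↦ hq' _ b))
    simpa only [AddMonoidHom.comp_apply] using e
  have hcontD : ∀ b : B, Continuous fun g : ↥(H ⊓ decomp 𝔭) ↦ g • b := fun b ↦
    (hcontB b).comp continuous_subtype_val
  intro z hz
  -- (Glob): a lift unramified outside `Σ`
  obtain ⟨y, hyunr, hyz⟩ := hglob z hz
  have hzmem := (mem_datumStrictSelmer_iff _).mp hz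
  -- the local components above `𝔭` die in `C`, hence come from `A`
  have hri : ∀ i : Fin (p ^ c), qD (resOfLe B (inf_le_left : H ⊓ decomp 𝔭 ≤ H) (conjH1 H B (τ i) y)) = 0 := by
    intro i
    rw [← hresB, ← hconjB, hyz]
    have h := hzmem.2 𝔭 h𝔭 (τ i)
    rw [AcSelmer.bdpData_self p 𝔭 h𝔭, mem_strictKer_strictDatum_iff] at h
    exact h
  have hwi : ∀ i : Fin (p ^ c), ∃ w : Literature.NumberTheory.EllipticCurves.subgroupH1 (H ⊓ decomp 𝔭) A,
      jD w = resOfLe B (inf_le_left : H ⊓ decomp 𝔭 ≤ H) (conjH1 H B (τ i) y) := fun i ↦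
    exists_resH1Hom_eq_of_resH1Hom_eq_zero (G := ↥(H ⊓ decomp 𝔭)) j (fun _ a ↦ hj' _ a) hinj q
      (fun _ b ↦ hq' _ b) hsurj hexact hcontD (hri i)
  choose w hw using hwi
  -- (Loc): a global class of `A` with these local components
  obtain ⟨a, haunr, ha⟩ := hloc w
  refine ⟨y - jH a, ?_, ?_⟩
  · rw [mem_datumStrictSelmer_iff]
    refine ⟨?_, fun v hv σ ↦ ?_⟩
    · -- unramified outside `Σ`
      refine sub_mem hyunr ?_
      rw [mem_unramifiedOutside_iff] at haunr ⊢
      intro v hvS hvp σ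
      rw [hconjA]
      exact resH1Hom_id_mem_unramifiedKer H v j hj' (fun _ a ↦ hj' _ a) (haunr v hvS hvp σ)
    · by_cases hv𝔭 : v = 𝔭
      · -- strict at `𝔭`: from the representatives
        subst hv𝔭
        rw [AcSelmer.bdpData_self p v hv, mem_strictKer_strictDatum_iff]
        refine hrepsB (y - jH a) (fun i hi ↦ ?_) σ
        rw [map_sub, map_sub, hconjA, hresA, ha ⟨i, hi⟩, hw ⟨i, hi⟩, sub_self]
      · rw [AcSelmer.bdpData_of_ne p 𝔭 hv hv𝔭, AcSelmer.strictKer_relaxedDatum_eq_top]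
        exact AddSubgroup.mem_top _
  · rw [map_sub, hyz, resH1Hom_id_comp_eq_zero (G := H) j (fun _ a ↦ hj' _ a) q (fun _ b ↦ hq' _ b) hqj, sub_zero]

/-! ### §2 The lower count from (Glob) ∧ (Loc) -/

/-- **`#R(A) · #R(C) ≤ #R(B) · #C^{G_{K_∞}}` from (Glob) ∧ (Loc)** (file 3 §3 with its surjectivity discharged by §1; `C` finite,
`R(B)` finite). [cite: KellerYin2024, Thm. 1.4.1 and Rem. 1.4.2 (arXiv:2402.12781v2 §1.4)] [cite: PollackWeston2011, App. A Prop. A.2] -/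
theorem natCard_mul_natCard_le_of_global_of_local [Finite C]
    (h𝔭 : ((p : ℕ) : 𝓞 K) ∈ 𝔭.asIdeal) (j : A →+ B)
    (hj' : ∀ (σ : absoluteGaloisGroup K) (a : A), j (σ • a) = σ • j a) (hinj : Function.Injective j)
    (q : B →+ C) (hq' : ∀ (σ : absoluteGaloisGroup K) (b : B), q (σ • b) = σ • q b)
    (hqj : ∀ a : A, q (j a) = 0) (hsurj : Function.Surjective q) (hexact : ∀ b : B, q b = 0 → ∃ a : A, j a = b)
    (hcontB : ∀ b : B, Continuous fun g : absoluteGaloisGroup K ↦ g • b)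
    (c : ℕ) (τ : ℕ → absoluteGaloisGroup K)
    (hrepsB : ∀ y : Literature.NumberTheory.EllipticCurves.subgroupH1 κ.kerSubgroup B,
      (∀ i, i < p ^ c → resOfLe B (inf_le_left : κ.kerSubgroup ⊓ decomp 𝔭 ≤ κ.kerSubgroup)
        (conjH1 κ.kerSubgroup B (τ i) y) = 0) →
      ∀ σ : absoluteGaloisGroup K, resOfLe B (inf_le_left : κ.kerSubgroup ⊓ decomp 𝔭 ≤ κ.kerSubgroup)
        (conjH1 κ.kerSubgroup B σ y) = 0)
    (hglob : ∀ z ∈ datumStrictSelmer κ.kerSubgroup C p (AcSelmer.bdpData C p 𝔭) S₀,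
      ∃ y ∈ unramifiedOutside κ.kerSubgroup B p S₀,
        resH1Hom (ContinuousMonoidHom.id κ.kerSubgroup) q (fun _ b ↦ hq' _ b) y = z)
    (hloc : ∀ w : Fin (p ^ c) → Literature.NumberTheory.EllipticCurves.subgroupH1 (κ.kerSubgroup ⊓ decomp 𝔭) A,
      ∃ a ∈ unramifiedOutside κ.kerSubgroup A p S₀,
        ∀ i : Fin (p ^ c), resOfLe A (inf_le_left : κ.kerSubgroup ⊓ decomp 𝔭 ≤ κ.kerSubgroup)
          (conjH1 κ.kerSubgroup A (τ i) a) = w i)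
    (hB : (datumStrictSelmer κ.kerSubgroup B p (AcSelmer.bdpData B p 𝔭) S₀ :
      Set (Literature.NumberTheory.EllipticCurves.subgroupH1 κ.kerSubgroup B)).Finite) :
    Nat.card (datumStrictSelmer κ.kerSubgroup A p (AcSelmer.bdpData A p 𝔭) S₀) *
        Nat.card (datumStrictSelmer κ.kerSubgroup C p (AcSelmer.bdpData C p 𝔭) S₀) ≤
      Nat.card (datumStrictSelmer κ.kerSubgroup B p (AcSelmer.bdpData B p 𝔭) S₀) *
        Nat.card {x : C // ∀ g : ↥κ.kerSubgroup, g • x = x} :=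
  ResidualDevissageCountSharp.natCard_mul_natCard_le_of_surjective_fixed κ 𝔭 S₀ j hj' hinj q hq' hqj hexact hB
    (surjOn_datumStrictSelmer_of_global_of_local κ 𝔭 S₀ h𝔭 j hj' hinj q hq' hqj hsurj hexact hcontB c τ hrepsB hglob hloc)

end Residual

/-! ### §3 Along a stable `Φ ≤ E[p]` -/

section Curve

variable {K : Type} [Field K] [NumberField K] (W : WeierstrassCurve K) [W.IsElliptic] {p : ℕ}
  [Fact p.Prime] (κ : ZpExtension K p)

/-- **`#R(Φ) · #R(E[p]/Φ) ≤ #R(E[p]) · #(E[p]/Φ)^{G_{K_∞}}` from (Glob) for `E[p] → E[p]/Φ` and (Loc) for `Φ` at the places above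
`𝔭`** — the «`≥`» half of the residual λ-count along a `Γ_K`-stable `Φ ≤ E[p]` with its one input split into the two standard
surjectivities (any number field, any `ℤ_p`-extension, `R(E[p])` finite, `p^c` representatives above `𝔭` for `E[p]`).
[cite: KellerYin2024, Thm. 1.4.1 and Rem. 1.4.2 (arXiv:2402.12781v2 §1.4)] [cite: GreenbergVatsal2000, §2 Prop. (2.1)] -/
theorem natCard_mul_le_of_stableSubgroup_of_global_of_local
    {𝔭 : HeightOneSpectrum (𝓞 K)} (h𝔭 : ((p : ℕ) : 𝓞 K) ∈ 𝔭.asIdeal) (S : Set (HeightOneSpectrum (𝓞 K)))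
    (Φ : StableSubgroup (absoluteGaloisGroup K) (W.geomTorsion (p : ℤ)))
    (c : ℕ) (τ : ℕ → absoluteGaloisGroup K)
    (hrepsE : ∀ y : Literature.NumberTheory.EllipticCurves.subgroupH1 κ.kerSubgroup (W.geomTorsion (p : ℤ)),
      (∀ i, i < p ^ c → resOfLe (W.geomTorsion (p : ℤ)) (inf_le_left : κ.kerSubgroup ⊓ decomp 𝔭 ≤ κ.kerSubgroup)
        (conjH1 κ.kerSubgroup (W.geomTorsion (p : ℤ)) (τ i) y) = 0) →
      ∀ σ : absoluteGaloisGroup K, resOfLe (W.geomTorsion (p : ℤ))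
        (inf_le_left : κ.kerSubgroup ⊓ decomp 𝔭 ≤ κ.kerSubgroup) (conjH1 κ.kerSubgroup (W.geomTorsion (p : ℤ)) σ y) = 0)
    (hglob : ∀ z ∈ datumStrictSelmer κ.kerSubgroup Φ.Quot p (AcSelmer.bdpData Φ.Quot p 𝔭) S,
      ∃ y ∈ unramifiedOutside κ.kerSubgroup (W.geomTorsion (p : ℤ)) p S,
        resH1Hom (ContinuousMonoidHom.id κ.kerSubgroup) Φ.proj (fun _ b ↦ Φ.proj_smul _ b) y = z)
    (hloc : ∀ w : Fin (p ^ c) → Literature.NumberTheory.EllipticCurves.subgroupH1 (κ.kerSubgroup ⊓ decomp 𝔭) Φ.Sub,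
      ∃ a ∈ unramifiedOutside κ.kerSubgroup Φ.Sub p S,
        ∀ i : Fin (p ^ c), resOfLe Φ.Sub (inf_le_left : κ.kerSubgroup ⊓ decomp 𝔭 ≤ κ.kerSubgroup)
          (conjH1 κ.kerSubgroup Φ.Sub (τ i) a) = w i)
    (hE : (datumStrictSelmer κ.kerSubgroup (W.geomTorsion (p : ℤ)) p (AcSelmer.bdpData _ p 𝔭) S :
      Set (Literature.NumberTheory.EllipticCurves.subgroupH1 κ.kerSubgroup (W.geomTorsion (p : ℤ)))).Finite) :
    Nat.card (datumStrictSelmer κ.kerSubgroup Φ.Sub p (AcSelmer.bdpData Φ.Sub p 𝔭) S) *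
        Nat.card (datumStrictSelmer κ.kerSubgroup Φ.Quot p (AcSelmer.bdpData Φ.Quot p 𝔭) S) ≤
      Nat.card (datumStrictSelmer κ.kerSubgroup (W.geomTorsion (p : ℤ)) p (AcSelmer.bdpData _ p 𝔭) S) *
        Nat.card {y : Φ.Quot // ∀ g : ↥κ.kerSubgroup, g • y = y} := by
  haveI : Finite Φ.Quot := ResidualDevissageCountLower.finite_quot_stableSubgroup W Φ
  exact natCard_mul_natCard_le_of_global_of_local κ 𝔭 S h𝔭 Φ.incl Φ.incl_smul Φ.incl_injective Φ.proj Φ.proj_smul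
    Φ.proj_incl Φ.proj_surjective (fun b hb ↦ AddMonoidHom.mem_range.mp (Φ.mem_range_incl_of_proj_eq_zero b hb))
    (continuous_smul_geomTorsion W (p : ℤ)) c τ hrepsE hglob hloc hE

end Curve

end Summit.BirchSwinnertonDyer.BirchSwinnertonDyer.Theorems.ResidualDevissageSurjectivity

end
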